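import Summits.QuantumFields.BalabanUV.T4Continuum.Support.VariationalCovariantAssembly
import Summits.QuantumFields.BalabanUV.T4Continuum.Support.VariationalCovariantFederbush
import Summits.QuantumFields.BalabanUV.T4Continuum.Support.VariationalCovariantPoincare

/-!
# T⁴ programme, spine node NE2 (U1a), lane P2 — THE SCALAR COVARIANT CANONICAL PAIR (charged scalar, U(1) background = King's model):
# the additive bracket `|Δ′_{k+1}(U′)(μ) − Δ′_k(Ū′)(μ)| ≤ (e + e′)·‖μ‖²` with the leaves FED⁺ and P⁺ DISCHARGED in the kernel,
# modulo the leaves UB⁺ / ONE⁺ / REG⁺ and global small-field frame data (`t4/skeletons/NE2-t4-ne2-p2.md` v0.6 §2.C/§3;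
# cell `pub-balaban`, row NE2 co-owner #2, lineage t4-ne2-p2 gen 10)

HONEST FRAMING (T4-DAG p. 1).  Rung (B)+1 only — NOT infinite volume, NOT a mass gap, NOT Clay.  NE2 is NOT IN PRINT and NOT proved here.
MODEL LEVEL: the bond phases `Rc` (level `n = L^k`), `R′` (level `nL`), the site transports `T`, `T′` ([Balaban1985BackgroundPropagators] (3.19)
shape, abelian) and the global unitary frames `G`, `G′` are DATA; scalar (0-form) sector; the effective actions are the constrained minimum values
`Δ′_k(Ū′)(μ) = min {Sc f : Q_T f = μ}`, `Δ′_{k+1}(U′)(μ) = min {Sf f′ : Q_T (Q_{T′} f′) = μ}` (`VariationalTransfer.blockSpin`; [Balaban1984PropagatorsI]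
p.26/(1.65) and (1.16)–(1.18) shapes; King's «effective Laplacian of the average scalar field» (2.14) p.653 WITH background, by duality).  WHAT IS
KERNEL HERE: the instantiation of `VariationalCovariantAssembly.pair_bracket` on these carriers with
  * P⁺ DISCHARGED at both levels from `VariationalCovariantPoincare.nsq_le_covariant_poincare` (the composite-constraint coercivity at level
    `nL` = one-step P⁺ + level-`n` P⁺ + FED⁺, `qV_le_composite`),
  * FED⁺ DISCHARGED from `VariationalCovariantFederbush.sum_dirU_Qc_le` in physical units (`Sc_Q1_le`: `Sc(Q_{T′}f′) ≤ (√Sf(f′) + √d·(n·m)·√qV(f′))²`),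
  * norm domination, continuity, surjectivity proved,
and UB⁺ (both levels), ONE⁺ (explicit covariant interpolant) and REG⁺ (Weitzenböck + Euler–Lagrange) as the REMAINING HYPOTHESES of exactly the
skeleton's shapes — **`scalar_pair_bracket`**.  Nothing printed is a hypothesis; no `def … : Prop` fact; no `sorry`; axioms standard.  Numerics
(`HOME/b2b-balaban-t4-ne2-p2-g10/`, kit j090499/j090707/j090813/j091055): at `U = 1` the increments are `82.4·L^{−2k}` (k ≤ 8); with background
`≈ 82·L^{−2k} + 4.3·α·L^{−k}`, the first-order term a unit-lattice frame rotation — i.e. `e ≍ α·L^{−k}` (FED⁺'s cross term) is the true order.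
HONEST DEPENDENCY (cell, verbatim): continuum YM on T⁴ ⇐ BetaPertH ∧ nine spine estimates (0/9 proved); BetaPertH ⇐ (D1) ∧ (D4) ∧ CAP+tail;
G-an2-4 gates asym, D1 and NE2/3/4.
-/

noncomputable section

namespace Summit.QuantumFields.BalabanUV.T4Continuum.VariationalCovariantScalarPair

open Finset
open Literature.MathematicalPhysics.QuantumFieldTheory.Balaban1983to89
open Literature.MathematicalPhysics.QuantumFieldTheory.Balaban1983to89.B5Prop11Plancherel (Tor fine unitVec)
open Literature.MathematicalPhysics.QuantumFieldTheory.Balaban1983to89.B5Prop11Lower (nsq nsq_nonneg)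
open Literature.MathematicalPhysics.QuantumFieldTheory.Balaban1983to89.B5Block118 (bpt)
open Literature.MathematicalPhysics.QuantumFieldTheory.Balaban1983to89.B5Blocks16 (blockOf blockOf_bpt)
open Summit.QuantumFields.BalabanUV.T4Continuum.VariationalTransfer (blockSpin)
open Summit.QuantumFields.BalabanUV.T4Continuum.VariationalCovariantFederbush (cD dirU Qc piT mis sum_dirU_Qc_le dirU_nonneg)
open Summit.QuantumFields.BalabanUV.T4Continuum.VariationalCovariantPoincare (QT dirR nsq_le_covariant_poincare)
open Summit.QuantumFields.BalabanUV.T4Continuum.VariationalCovariantAssembly (pair_bracket)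

variable {d : ℕ} (n L : ℕ) [NeZero n] [NeZero L] (M : Fin d → ℕ) [hM : ∀ μ, NeZero (M μ)]

/-! ## §1 The objects: forms and sizes in physical units, the two averagings -/

/-- the level-`n` covariant Dirichlet form in physical units: `Sc f = n^{2−d}·Σ_{μ,x}|Rc(x,μ)f(x+e_μ) − f(x)|²` ([B9] (3.23) shape).
[cite: Balaban1985BackgroundPropagators, (3.23) p.394 (shape; abelian)] [folklore] -/
def Sc (Rc : Tor (fine n M) → Fin d → ℂ) (f : Tor (fine n M) → ℂ) : ℝ :=
  (n : ℝ) ^ 2 / (n : ℝ) ^ d * ∑ μ, dirU (fine n M) Rc f μ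

/-- the level-`nL` covariant Dirichlet form in physical units. [folklore] -/
def Sf (R' : Tor (fine L (fine n M)) → Fin d → ℂ) (f' : Tor (fine L (fine n M)) → ℂ) : ℝ :=
  ((n : ℝ) * L) ^ 2 / ((n : ℝ) * L) ^ d * ∑ μ, dirU (fine L (fine n M)) R' f' μ

/-- `L²` size of a level-`n` field in physical units: `n^{−d}·Σ|f|²`. [folklore] -/
def qW (f : Tor (fine n M) → ℂ) : ℝ := ((n : ℝ) ^ d)⁻¹ * nsq f

/-- `L²` size of a level-`nL` field in physical units. [folklore] -/
def qV (f' : Tor (fine L (fine n M)) → ℂ) : ℝ := (((n : ℝ) * L) ^ d)⁻¹ * nsq f'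

/-- the k-block transported average `Q_T : (Tor (fine n M) → ℂ) → (Tor M → ℂ)`. [folklore] -/
def Qk (T : Tor (fine n M) → ℂ) (f : Tor (fine n M) → ℂ) : Tor M → ℂ := fun z => Qc n M T f z

/-- the one-step transported average `Q_{T′} : (Tor (fine L (fine n M)) → ℂ) → (Tor (fine n M) → ℂ)`. [folklore] -/
def Q1 (T' : Tor (fine L (fine n M)) → ℂ) (f' : Tor (fine L (fine n M)) → ℂ) : Tor (fine n M) → ℂ := fun y => Qc L (fine n M) T' f' y

/-! ## §2 Generic properties: nonnegativity, norm domination, continuity, surjectivity -/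

/-- the coarse form is nonnegative. [folklore] -/
theorem Sc_nonneg (Rc : Tor (fine n M) → Fin d → ℂ) (f : Tor (fine n M) → ℂ) : 0 ≤ Sc n M Rc f :=
  mul_nonneg (by positivity) (sum_nonneg fun μ _ => dirU_nonneg _ _ _ _)

/-- the fine form is nonnegative. [folklore] -/
theorem Sf_nonneg (R' : Tor (fine L (fine n M)) → Fin d → ℂ) (f' : Tor (fine L (fine n M)) → ℂ) : 0 ≤ Sf n L M R' f' :=
  mul_nonneg (by positivity) (sum_nonneg fun μ _ => dirU_nonneg _ _ _ _)

/-- the coarse size is nonnegative. [folklore] -/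
theorem qW_nonneg (f : Tor (fine n M) → ℂ) : 0 ≤ qW n M f := mul_nonneg (by positivity) (nsq_nonneg f)

/-- the fine size is nonnegative. [folklore] -/
theorem qV_nonneg (f' : Tor (fine L (fine n M)) → ℂ) : 0 ≤ qV n L M f' := mul_nonneg (by positivity) (nsq_nonneg f')

/-- the sup norm is dominated by the `ℓ²` mass: `‖f‖² ≤ Σ|f x|²`. [folklore] -/
theorem norm_sq_le_nsq {ι : Type*} [Fintype ι] (f : ι → ℂ) : ‖f‖ ^ 2 ≤ nsq f := by
  have h0 : 0 ≤ nsq f := nsq_nonneg f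
  have h : ‖f‖ ≤ Real.sqrt (nsq f) := by
    refine (pi_norm_le_iff_of_nonneg (Real.sqrt_nonneg _)).mpr fun i => ?_
    rw [← Real.sqrt_sq (norm_nonneg (f i))]
    refine Real.sqrt_le_sqrt ?_
    unfold nsq
    exact Finset.single_le_sum (f := fun j => ‖f j‖ ^ 2) (fun j _ => sq_nonneg _) (Finset.mem_univ i)
  calc ‖f‖ ^ 2 ≤ Real.sqrt (nsq f) ^ 2 := pow_le_pow_left₀ (norm_nonneg _) h 2
    _ = nsq f := Real.sq_sqrt h0

/-- norm domination at level `n`: `‖f‖² ≤ n^d·qW f`. [folklore] -/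
theorem norm_sq_le_qW (f : Tor (fine n M) → ℂ) : ‖f‖ ^ 2 ≤ (n : ℝ) ^ d * qW n M f := by
  have hn : (0 : ℝ) < (n : ℝ) ^ d := by have := NeZero.ne n; positivity
  rw [qW, ← mul_assoc, mul_inv_cancel₀ hn.ne', one_mul]
  exact norm_sq_le_nsq f

/-- norm domination at level `nL`: `‖f′‖² ≤ (nL)^d·qV f′`. [folklore] -/
theorem norm_sq_le_qV (f' : Tor (fine L (fine n M)) → ℂ) : ‖f'‖ ^ 2 ≤ ((n : ℝ) * L) ^ d * qV n L M f' := by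
  have hn : (0 : ℝ) < ((n : ℝ) * L) ^ d := by have := NeZero.ne n; have := NeZero.ne L; positivity
  rw [qV, ← mul_assoc, mul_inv_cancel₀ hn.ne', one_mul]
  exact norm_sq_le_nsq f'

/-- the transported average is continuous (a linear map on a finite-dimensional space). [folklore] -/
theorem continuous_Qc {Lb : ℕ} [NeZero Lb] {N : Fin d → ℕ} [∀ μ, NeZero (N μ)] (T' : Tor (fine Lb N) → ℂ) :
    Continuous fun f' : Tor (fine Lb N) → ℂ => fun y => Qc Lb N T' f' y := by
  refine continuous_pi fun y => ?_
  unfold Qc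
  fun_prop

/-- the covariant Dirichlet sums are continuous. [folklore] -/
theorem continuous_sum_dirU {N : Fin d → ℕ} [∀ μ, NeZero (N μ)] (R : Tor N → Fin d → ℂ) (c : ℝ) :
    Continuous fun f : Tor N → ℂ => c * ∑ μ, dirU N R f μ := by
  unfold dirU cD
  fun_prop

/-- the one-step transported average with unit-modulus transports is onto (right inverse: `f′ = conj T′ · (λ ∘ blockOf)`). [folklore] -/
theorem Q1_surjective (T' : Tor (fine L (fine n M)) → ℂ) (hT1 : ∀ x, ‖T' x‖ = 1) :
    Function.Surjective (Q1 n L M T') := by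
  intro lam
  refine ⟨fun x => (starRingEnd ℂ) (T' x) * lam (blockOf L (fine n M) x), ?_⟩
  funext y
  have hL : ((L : ℂ) ^ d) ≠ 0 := pow_ne_zero _ (by exact_mod_cast NeZero.ne L)
  have hcard : (Finset.univ : Finset (Fin d → Fin L)).card = L ^ d := by
    rw [Finset.card_univ, Fintype.card_fun, Fintype.card_fin, Fintype.card_fin]
  have hTT : ∀ x, T' x * (starRingEnd ℂ) (T' x) = 1 := fun x => by
    rw [Complex.mul_conj, Complex.normSq_eq_norm_sq, hT1, one_pow, Complex.ofReal_one]
  simp only [Q1, Qc, blockOf_bpt]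
  have : ∀ j : Fin d → Fin L, T' (bpt L (fine n M) y j) * ((starRingEnd ℂ) (T' (bpt L (fine n M) y j)) * lam y) = lam y := fun j => by
    rw [← mul_assoc, hTT, one_mul]
  simp_rw [this]
  rw [sum_const, hcard, nsmul_eq_mul, Nat.cast_pow, ← mul_assoc, inv_mul_cancel₀ hL, one_mul]

/-! ## §3 Dictionary to the leaf modules' lattice-unit objects -/

/-- `VariationalCovariantPoincare.QT` IS `VariationalCovariantFederbush.Qc` (same defining sum). [folklore] -/
theorem QT_eq_Qc {Lb : ℕ} [NeZero Lb] {N : Fin d → ℕ} [∀ μ, NeZero (N μ)] (T' : Tor (fine Lb N) → ℂ) (f' : Tor (fine Lb N) → ℂ)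
    (y : Tor N) : QT Lb N T' f' y = Qc Lb N T' f' y := rfl

/-- `VariationalCovariantPoincare.dirR = Σ_μ VariationalCovariantFederbush.dirU`. [folklore] -/
theorem dirR_eq_sum_dirU {Lb : ℕ} [NeZero Lb] {N : Fin d → ℕ} [∀ μ, NeZero (N μ)] (R : Tor (fine Lb N) → Fin d → ℂ)
    (f : Tor (fine Lb N) → ℂ) : dirR Lb N R f = ∑ μ, dirU (fine Lb N) R f μ := rfl

omit [NeZero n] in
/-- `Σ_z ‖(Q_T f)(z)‖² = nsq (Q_T f)`. [folklore] -/
theorem sum_normSq_QT (T f : Tor (fine n M) → ℂ) : ∑ z, ‖QT n M T f z‖ ^ 2 = nsq (Qk n M T f) := rfl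

/-! ## §4 Leaf P⁺ DISCHARGED at both levels (coercivity in physical units) -/

omit [NeZero n] [NeZero L] hM in
/-- arithmetic: `nd⁻¹·(8·nd·Z + 32·d·n2·D) = 8·Z + 32·d·(n2/nd·D)`. [folklore] -/
theorem arith_coarse {nd n2 Z D dd : ℝ} (hnd : nd ≠ 0) :
    nd⁻¹ * (8 * nd * Z + 32 * dd * n2 * D) = 8 * Z + 32 * dd * (n2 / nd * D) := by
  field_simp

/-- **P⁺ at level `n`** (from `nsq_le_covariant_poincare`): `qW f ≤ 8·nsq (Q_T f) + 32d·Sc f ≤ (1088d + 128)·(Sc f + nsq (Q_T f))`. [folklore] -/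
theorem qW_le_coarse {Rc : Tor (fine n M) → Fin d → ℂ} {T G : Tor (fine n M) → ℂ} {c : Tor M → ℂ}
    (hG : ∀ x, ‖G x‖ = 1) (hc : ∀ z, ‖c z‖ ≤ 1) {mG mB : ℝ}
    (hframe : ∀ x μ, ‖G (x + unitVec (fine n M) μ) - G x * Rc x μ‖ ≤ mG)
    (hblock : ∀ z j, ‖G (bpt n M z j) - c z * T (bpt n M z j)‖ ≤ mB)
    (hsmall : 16 * (d : ℝ) ^ 2 * ((n : ℝ) * mG) ^ 2 + 4 * mB ^ 2 ≤ 1 / 2) (f : Tor (fine n M) → ℂ) :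
    qW n M f ≤ (1088 * d + 128) * (Sc n M Rc f + nsq (Qk n M T f)) := by
  have hn : (0 : ℝ) < (n : ℝ) ^ d := by have := NeZero.ne n; positivity
  set Z : ℝ := nsq (Qk n M T f) with hZ
  set D : ℝ := ∑ μ, dirU (fine n M) Rc f μ with hD
  have hP : nsq f ≤ 8 * (n : ℝ) ^ d * Z + 32 * d * (n : ℝ) ^ 2 * D :=
    nsq_le_covariant_poincare n M (R := Rc) (T := T) (G := G) (c := c) (mG := mG) (mB := mB) hG hc hframe hblock hsmall f
  have hD0 : 0 ≤ D := sum_nonneg fun μ _ => dirU_nonneg _ _ _ _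
  have hZ0 : 0 ≤ Z := nsq_nonneg _
  have hd : (0 : ℝ) ≤ d := Nat.cast_nonneg d
  have hSc : Sc n M Rc f = (n : ℝ) ^ 2 / (n : ℝ) ^ d * D := rfl
  have h1 : qW n M f ≤ 8 * Z + 32 * d * Sc n M Rc f := by
    unfold qW
    rw [hSc, ← arith_coarse hn.ne']
    exact mul_le_mul_of_nonneg_left hP (by positivity)
  have hSc0 : 0 ≤ Sc n M Rc f := Sc_nonneg n M Rc f
  linarith [mul_nonneg hd hZ0, mul_nonneg hd hSc0, h1]

omit [NeZero n] [NeZero L] hM in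
/-- arithmetic: `nd⁻¹·(128·nd·Z + 1088·d·(n2·DX)) = 128·Z + 1088·d·(n2/nd·DX)`. [folklore] -/
theorem arith_fine {nd n2 Z DX dd : ℝ} (hnd : nd ≠ 0) :
    nd⁻¹ * (128 * nd * Z + 1088 * dd * (n2 * DX)) = 128 * Z + 1088 * dd * (n2 / nd * DX) := by
  field_simp

/-- **P⁺ for the COMPOSITE constraint at level `nL`** = one-step P⁺ (blocks of side `L`, frame `G′`) + level-`n` P⁺ (frame `G`) + FED⁺:
`qV f′ ≤ (1088d + 128)·(Sf f′ + nsq (Q_T (Q_{T′} f′)))`, provided `512·d²·(n·m)² ≤ 1/2` (mismatch absorption). [folklore] -/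
theorem qV_le_composite {Rc : Tor (fine n M) → Fin d → ℂ} {R' : Tor (fine L (fine n M)) → Fin d → ℂ}
    {T G : Tor (fine n M) → ℂ} {T' G' : Tor (fine L (fine n M)) → ℂ} {c : Tor M → ℂ} {c' : Tor (fine n M) → ℂ}
    (hG : ∀ x, ‖G x‖ = 1) (hc : ∀ z, ‖c z‖ ≤ 1) {mG mB : ℝ}
    (hframe : ∀ x μ, ‖G (x + unitVec (fine n M) μ) - G x * Rc x μ‖ ≤ mG)
    (hblock : ∀ z j, ‖G (bpt n M z j) - c z * T (bpt n M z j)‖ ≤ mB)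
    (hsmall : 16 * (d : ℝ) ^ 2 * ((n : ℝ) * mG) ^ 2 + 4 * mB ^ 2 ≤ 1 / 2)
    (hG' : ∀ x, ‖G' x‖ = 1) (hc' : ∀ y, ‖c' y‖ ≤ 1) {mG' mB' : ℝ}
    (hframe' : ∀ x μ, ‖G' (x + unitVec (fine L (fine n M)) μ) - G' x * R' x μ‖ ≤ mG')
    (hblock' : ∀ y j, ‖G' (bpt L (fine n M) y j) - c' y * T' (bpt L (fine n M) y j)‖ ≤ mB')
    (hsmall' : 16 * (d : ℝ) ^ 2 * ((L : ℝ) * mG') ^ 2 + 4 * mB' ^ 2 ≤ 1 / 2)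
    (hR' : ∀ x μ, ‖R' x μ‖ ≤ 1) (hT' : ∀ x, ‖T' x‖ ≤ 1) {m : ℝ} (hm : 0 ≤ m)
    (hmis : ∀ y μ j, ‖mis L (fine n M) Rc R' T' y μ j‖ ≤ m) (habsorb : 512 * (d : ℝ) ^ 2 * ((n : ℝ) * m) ^ 2 ≤ 1 / 2)
    (f' : Tor (fine L (fine n M)) → ℂ) :
    qV n L M f' ≤ (1088 * d + 128) * (Sf n L M R' f' + nsq (Qk n M T (Q1 n L M T' f'))) := by
  have hn1 : (1 : ℝ) ≤ n := by exact_mod_cast Nat.one_le_iff_ne_zero.mpr (NeZero.ne n)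
  have hn0 : (0 : ℝ) < n := by exact_mod_cast Nat.pos_of_ne_zero (NeZero.ne n)
  have hL0 : (0 : ℝ) < L := by exact_mod_cast Nat.pos_of_ne_zero (NeZero.ne L)
  have hLd : (0 : ℝ) < (L : ℝ) ^ d := pow_pos hL0 d
  have hnLd : (0 : ℝ) < ((n : ℝ) * L) ^ d := pow_pos (mul_pos hn0 hL0) d
  have hd : (0 : ℝ) ≤ d := Nat.cast_nonneg d
  -- the real atoms
  set lam : Tor (fine n M) → ℂ := Q1 n L M T' f' with hlam
  set Y : ℝ := nsq f' with hY
  set DX : ℝ := ∑ μ, dirU (fine L (fine n M)) R' f' μ with hDX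
  set P : ℝ := nsq lam with hPdef
  set Z : ℝ := nsq (Qk n M T lam) with hZ
  set E : ℝ := ∑ μ, dirU (fine n M) Rc lam μ with hE
  have hY0 : 0 ≤ Y := nsq_nonneg _
  have hDX0 : 0 ≤ DX := sum_nonneg fun μ _ => dirU_nonneg _ _ _ _
  have hZ0 : 0 ≤ Z := nsq_nonneg _
  have hE0 : 0 ≤ E := sum_nonneg fun μ _ => dirU_nonneg _ _ _ _
  -- s1: one-step P⁺ (blocks of side L over the level-n torus)
  have s1 : Y ≤ 8 * (L : ℝ) ^ d * P + 32 * d * (L : ℝ) ^ 2 * DX :=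
    nsq_le_covariant_poincare L (fine n M) (R := R') (T := T') (G := G') (c := c') (mG := mG') (mB := mB')
      hG' hc' hframe' hblock' hsmall' f'
  -- s2: level-n P⁺ applied to the one-step average
  have s2 : P ≤ 8 * (n : ℝ) ^ d * Z + 32 * d * (n : ℝ) ^ 2 * E :=
    nsq_le_covariant_poincare n M (R := Rc) (T := T) (G := G) (c := c) (mG := mG) (mB := mB) hG hc hframe hblock hsmall lam
  -- s3: FED⁺ bounds the coarse Dirichlet sum of the average
  have s3 : (L : ℝ) ^ d * E ≤ 2 * (L : ℝ) ^ 2 * DX + 2 * d * m ^ 2 * Y := by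
    have h : E ≤ (Real.sqrt ((L : ℝ) ^ 2 * DX / (L : ℝ) ^ d) + Real.sqrt d * (m * Real.sqrt (Y / (L : ℝ) ^ d))) ^ 2 :=
      sum_dirU_Qc_le L (fine n M) Rc R' T' hR' hT' hm hmis f'
    have ha : 0 ≤ (L : ℝ) ^ 2 * DX / (L : ℝ) ^ d := div_nonneg (mul_nonneg (sq_nonneg _) hDX0) hLd.le
    have hb : 0 ≤ Y / (L : ℝ) ^ d := div_nonneg hY0 hLd.le
    set A : ℝ := Real.sqrt ((L : ℝ) ^ 2 * DX / (L : ℝ) ^ d) with hA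
    set B : ℝ := Real.sqrt d * (m * Real.sqrt (Y / (L : ℝ) ^ d)) with hB
    have hA2 : A ^ 2 = (L : ℝ) ^ 2 * DX / (L : ℝ) ^ d := Real.sq_sqrt ha
    have hB2 : B ^ 2 = d * (m ^ 2 * (Y / (L : ℝ) ^ d)) := by
      rw [hB, mul_pow, mul_pow, Real.sq_sqrt hd, Real.sq_sqrt hb]
    have h3 : E ≤ 2 * ((L : ℝ) ^ 2 * DX / (L : ℝ) ^ d) + 2 * (d * (m ^ 2 * (Y / (L : ℝ) ^ d))) := by
      rw [← hA2, ← hB2]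
      have hab : (A + B) ^ 2 ≤ 2 * A ^ 2 + 2 * B ^ 2 := by nlinarith [sq_nonneg (A - B)]
      exact h.trans hab
    have h4 := mul_le_mul_of_nonneg_left h3 hLd.le
    have e : (L : ℝ) ^ d * (2 * ((L : ℝ) ^ 2 * DX / (L : ℝ) ^ d) + 2 * (d * (m ^ 2 * (Y / (L : ℝ) ^ d))))
        = 2 * (L : ℝ) ^ 2 * DX + 2 * d * m ^ 2 * Y := by field_simp
    rwa [e] at h4
  -- combine the three
  have t1 : 8 * (L : ℝ) ^ d * P ≤ 8 * (L : ℝ) ^ d * (8 * (n : ℝ) ^ d * Z + 32 * d * (n : ℝ) ^ 2 * E) :=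
    mul_le_mul_of_nonneg_left s2 (by positivity)
  have t3 : 256 * d * (n : ℝ) ^ 2 * ((L : ℝ) ^ d * E) ≤ 256 * d * (n : ℝ) ^ 2 * (2 * (L : ℝ) ^ 2 * DX + 2 * d * m ^ 2 * Y) :=
    mul_le_mul_of_nonneg_left s3 (by positivity)
  have comb : Y ≤ 64 * ((n : ℝ) ^ d * (L : ℝ) ^ d) * Z + (512 * d * (n : ℝ) ^ 2 * (L : ℝ) ^ 2 + 32 * d * (L : ℝ) ^ 2) * DX
      + 512 * (d : ℝ) ^ 2 * ((n : ℝ) * m) ^ 2 * Y := by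
    linarith [s1, t1, t3]
  -- absorb the mismatch term and clean up
  have hpow : (n : ℝ) ^ d * (L : ℝ) ^ d = ((n : ℝ) * L) ^ d := by rw [mul_pow]
  rw [hpow] at comb
  have t4 : 512 * (d : ℝ) ^ 2 * ((n : ℝ) * m) ^ 2 * Y ≤ 1 / 2 * Y := mul_le_mul_of_nonneg_right habsorb hY0
  have hL2 : (L : ℝ) ^ 2 * DX ≤ ((n : ℝ) * L) ^ 2 * DX := by
    refine mul_le_mul_of_nonneg_right ?_ hDX0
    rw [mul_pow]
    calc (L : ℝ) ^ 2 = 1 * (L : ℝ) ^ 2 := (one_mul _).symm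
      _ ≤ (n : ℝ) ^ 2 * (L : ℝ) ^ 2 := mul_le_mul_of_nonneg_right (one_le_pow₀ hn1) (sq_nonneg _)
  have hY : Y ≤ 128 * ((n : ℝ) * L) ^ d * Z + 1088 * d * (((n : ℝ) * L) ^ 2 * DX) := by
    have t5 : 64 * (d : ℝ) * ((L : ℝ) ^ 2 * DX) ≤ 64 * d * (((n : ℝ) * L) ^ 2 * DX) := mul_le_mul_of_nonneg_left hL2 (by positivity)
    linarith [comb, t4, t5]
  -- physical units
  have hSf : Sf n L M R' f' = ((n : ℝ) * L) ^ 2 / ((n : ℝ) * L) ^ d * DX := rfl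
  have hqV : qV n L M f' = (((n : ℝ) * L) ^ d)⁻¹ * Y := rfl
  rw [hqV, hSf]
  have h5 : (((n : ℝ) * L) ^ d)⁻¹ * Y ≤ 128 * Z + 1088 * d * (((n : ℝ) * L) ^ 2 / ((n : ℝ) * L) ^ d * DX) := by
    rw [← arith_fine hnLd.ne']
    exact mul_le_mul_of_nonneg_left hY (by positivity)
  have hS0 : 0 ≤ ((n : ℝ) * L) ^ 2 / ((n : ℝ) * L) ^ d * DX := mul_nonneg (div_nonneg (sq_nonneg _) hnLd.le) hDX0
  linarith [mul_nonneg hd hZ0, mul_nonneg hd hS0, h5, hS0, hZ0]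

/-! ## §5 Leaf FED⁺ DISCHARGED in physical units -/

/-- **FED⁺ (physical units)**: `Sc(Q_{T′} f′) ≤ (√Sf(f′) + √d·(n·m)·√qV(f′))²` (from `sum_dirU_Qc_le` by scaling with `n²/n^d`). [folklore] -/
theorem Sc_Q1_le {Rc : Tor (fine n M) → Fin d → ℂ} {R' : Tor (fine L (fine n M)) → Fin d → ℂ} {T' : Tor (fine L (fine n M)) → ℂ}
    (hR' : ∀ x μ, ‖R' x μ‖ ≤ 1) (hT' : ∀ x, ‖T' x‖ ≤ 1) {m : ℝ} (hm : 0 ≤ m)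
    (hmis : ∀ y μ j, ‖mis L (fine n M) Rc R' T' y μ j‖ ≤ m) (f' : Tor (fine L (fine n M)) → ℂ) :
    Sc n M Rc (Q1 n L M T' f') ≤ (Real.sqrt (Sf n L M R' f') + Real.sqrt d * ((n : ℝ) * m) * Real.sqrt (qV n L M f')) ^ 2 := by
  have hn : (0 : ℝ) < (n : ℝ) := by exact_mod_cast Nat.pos_of_ne_zero (NeZero.ne n)
  have hnd : (0 : ℝ) < (n : ℝ) ^ d := by positivity
  have hLd : (0 : ℝ) < (L : ℝ) ^ d := by have := NeZero.ne L; positivity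
  set c : ℝ := (n : ℝ) ^ 2 / (n : ℝ) ^ d with hcdef
  have hc0 : 0 ≤ c := by positivity
  set DX : ℝ := ∑ μ, dirU (fine L (fine n M)) R' f' μ with hDX
  set Y : ℝ := nsq f' with hYdef
  have h : ∑ μ, dirU (fine n M) Rc (Qc L (fine n M) T' f') μ
      ≤ (Real.sqrt ((L : ℝ) ^ 2 * DX / (L : ℝ) ^ d) + Real.sqrt d * (m * Real.sqrt (Y / (L : ℝ) ^ d))) ^ 2 :=
    sum_dirU_Qc_le L (fine n M) Rc R' T' hR' hT' hm hmis f'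
  have hSc : Sc n M Rc (Q1 n L M T' f') = c * ∑ μ, dirU (fine n M) Rc (Qc L (fine n M) T' f') μ := rfl
  have hSf : Sf n L M R' f' = ((n : ℝ) * L) ^ 2 / ((n : ℝ) * L) ^ d * DX := rfl
  have hqV : qV n L M f' = (((n : ℝ) * L) ^ d)⁻¹ * Y := rfl
  have e1 : Real.sqrt c * Real.sqrt ((L : ℝ) ^ 2 * DX / (L : ℝ) ^ d) = Real.sqrt (Sf n L M R' f') := by
    rw [← Real.sqrt_mul hc0, hSf]
    congr 1
    rw [hcdef, mul_pow, mul_pow]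
    field_simp
  have e2 : Real.sqrt c * (Real.sqrt d * (m * Real.sqrt (Y / (L : ℝ) ^ d)))
      = Real.sqrt d * ((n : ℝ) * m) * Real.sqrt (qV n L M f') := by
    have h1 : Real.sqrt c * Real.sqrt (Y / (L : ℝ) ^ d) = n * Real.sqrt (qV n L M f') := by
      have e : c * (Y / (L : ℝ) ^ d) = (n : ℝ) ^ 2 * qV n L M f' := by
        rw [hqV, hcdef, mul_pow]; field_simp
      rw [← Real.sqrt_mul hc0, e, Real.sqrt_mul (sq_nonneg _), Real.sqrt_sq hn.le]
    calc Real.sqrt c * (Real.sqrt d * (m * Real.sqrt (Y / (L : ℝ) ^ d)))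
        = Real.sqrt d * m * (Real.sqrt c * Real.sqrt (Y / (L : ℝ) ^ d)) := by ring
      _ = _ := by rw [h1]; ring
  have hsq : Real.sqrt c ^ 2 = c := Real.sq_sqrt hc0
  have key : ∀ a b : ℝ, c * (a + b) ^ 2 = (Real.sqrt c * a + Real.sqrt c * b) ^ 2 := by
    intro a b
    calc c * (a + b) ^ 2 = Real.sqrt c ^ 2 * (a + b) ^ 2 := by rw [hsq]
      _ = (Real.sqrt c * a + Real.sqrt c * b) ^ 2 := by ring
  calc Sc n M Rc (Q1 n L M T' f') = c * ∑ μ, dirU (fine n M) Rc (Qc L (fine n M) T' f') μ := hSc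
    _ ≤ c * (Real.sqrt ((L : ℝ) ^ 2 * DX / (L : ℝ) ^ d) + Real.sqrt d * (m * Real.sqrt (Y / (L : ℝ) ^ d))) ^ 2 :=
        mul_le_mul_of_nonneg_left h hc0
    _ = (Real.sqrt c * Real.sqrt ((L : ℝ) ^ 2 * DX / (L : ℝ) ^ d)
          + Real.sqrt c * (Real.sqrt d * (m * Real.sqrt (Y / (L : ℝ) ^ d)))) ^ 2 := key _ _
    _ = _ := by rw [e1, e2]

/-! ## §6 THE SCALAR COVARIANT CANONICAL PAIR: the additive bracket with FED⁺ and P⁺ discharged -/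

/-- **THE ADDITIVE BRACKET FOR KING'S CHARGED SCALAR, CANONICAL PAIR** (model level; skeleton §3 instantiated): for bond phases `Rc`
(level `n`), `R′` (level `nL`), site transports `T`, `T′` (`‖·‖ ≤ 1`, `‖T′‖ = 1`), global unitary frames `G`, `G′` with block phases `c`, `c′`
and the GLOBAL SMALL-FIELD conditions (frame defects `m_G, m_B, m_G′, m_B′`, one-block mismatch `m`, with `16d²(n m_G)² + 4m_B² ≤ ½`,
`16d²(L m_G′)² + 4m_B′² ≤ ½`, `512d²(n m)² ≤ ½`), and ASSUMING the three open leaves UB⁺ (both levels), ONE⁺ (with a regularity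
functional `ρ`, constants `ε₁, ε₂`) and REG⁺ (`C_R`): for every unit datum `μ`,
`Δ′_k(Ū′)(μ) ≤ Δ′_{k+1}(U′)(μ) + e·nsq μ` and `Δ′_{k+1}(U′)(μ) ≤ Δ′_k(Ū′)(μ) + e′·nsq μ` with
`e = 2δ√(Λ·C_P(Λ+1)) + δ²·C_P(Λ+1)`, `δ = √d·(n·m)`, `C_P = 1088d + 128`, `e′ = (ε₁C_R + ε₂C_P)(Λ+1)`.
FED⁺ and P⁺ are DISCHARGED (tree leaves); nothing of NE3; no propagator localisation. [folklore] -/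
theorem scalar_pair_bracket {Rc : Tor (fine n M) → Fin d → ℂ} {R' : Tor (fine L (fine n M)) → Fin d → ℂ}
    {T G : Tor (fine n M) → ℂ} {T' G' : Tor (fine L (fine n M)) → ℂ} {c : Tor M → ℂ} {c' : Tor (fine n M) → ℂ}
    (hG : ∀ x, ‖G x‖ = 1) (hc : ∀ z, ‖c z‖ ≤ 1) {mG mB : ℝ}
    (hframe : ∀ x μ, ‖G (x + unitVec (fine n M) μ) - G x * Rc x μ‖ ≤ mG)
    (hblock : ∀ z j, ‖G (bpt n M z j) - c z * T (bpt n M z j)‖ ≤ mB)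
    (hsmall : 16 * (d : ℝ) ^ 2 * ((n : ℝ) * mG) ^ 2 + 4 * mB ^ 2 ≤ 1 / 2)
    (hG' : ∀ x, ‖G' x‖ = 1) (hc' : ∀ y, ‖c' y‖ ≤ 1) {mG' mB' : ℝ}
    (hframe' : ∀ x μ, ‖G' (x + unitVec (fine L (fine n M)) μ) - G' x * R' x μ‖ ≤ mG')
    (hblock' : ∀ y j, ‖G' (bpt L (fine n M) y j) - c' y * T' (bpt L (fine n M) y j)‖ ≤ mB')
    (hsmall' : 16 * (d : ℝ) ^ 2 * ((L : ℝ) * mG') ^ 2 + 4 * mB' ^ 2 ≤ 1 / 2)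
    (hR' : ∀ x μ, ‖R' x μ‖ ≤ 1) (hT' : ∀ x, ‖T' x‖ ≤ 1) (hT1 : ∀ x, ‖T' x‖ = 1) {m : ℝ} (hm : 0 ≤ m)
    (hmis : ∀ y μ j, ‖mis L (fine n M) Rc R' T' y μ j‖ ≤ m) (habsorb : 512 * (d : ℝ) ^ 2 * ((n : ℝ) * m) ^ 2 ≤ 1 / 2)
    {Λ CR ε₁ ε₂ : ℝ} (hΛ : 0 ≤ Λ) (hCR : 0 ≤ CR) (hε₁ : 0 ≤ ε₁) (hε₂ : 0 ≤ ε₂) {ρ : (Tor (fine n M) → ℂ) → ℝ}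
    -- leaf UB⁺ at both levels (open: explicit covariant interpolant)
    (hUBc : ∀ μ : Tor M → ℂ, ∃ f, Qk n M T f = μ ∧ Sc n M Rc f ≤ Λ * nsq μ)
    (hUBf : ∀ μ : Tor M → ℂ, ∃ f', Qk n M T (Q1 n L M T' f') = μ ∧ Sf n L M R' f' ≤ Λ * nsq μ)
    -- leaf ONE⁺ (open) and leaf REG⁺ (open)
    (hONE : ∀ f, blockSpin (Q1 n L M T') (Sf n L M R') f ≤ Sc n M Rc f + ε₁ * ρ f + ε₂ * qW n M f)
    (hREG : ∀ (μ : Tor M → ℂ) f, Qk n M T f = μ → (∀ g, Qk n M T g = μ → Sc n M Rc f ≤ Sc n M Rc g) →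
      ρ f ≤ CR * (Sc n M Rc f + nsq μ))
    (μ : Tor M → ℂ) :
    blockSpin (Qk n M T) (Sc n M Rc) μ ≤ blockSpin (Qk n M T ∘ Q1 n L M T') (Sf n L M R') μ
        + (2 * (Real.sqrt d * ((n : ℝ) * m)) * Real.sqrt (Λ * ((1088 * d + 128) * (Λ + 1)))
            + (Real.sqrt d * ((n : ℝ) * m)) ^ 2 * ((1088 * d + 128) * (Λ + 1))) * nsq μ ∧
      blockSpin (Qk n M T ∘ Q1 n L M T') (Sf n L M R') μ ≤ blockSpin (Qk n M T) (Sc n M Rc) μ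
        + ((ε₁ * CR + ε₂ * (1088 * d + 128)) * (Λ + 1)) * nsq μ := by
  have hL1 : (1 : ℝ) ≤ L := by exact_mod_cast Nat.one_le_iff_ne_zero.mpr (NeZero.ne L)
  have hnLd : (0 : ℝ) ≤ ((n : ℝ) * L) ^ d := by positivity
  have hCP : (0 : ℝ) ≤ 1088 * d + 128 := by positivity
  have hδ : 0 ≤ Real.sqrt d * ((n : ℝ) * m) := by positivity
  -- norm dominations with the common constant κ = (nL)^d
  have hnormW : ∀ f : Tor (fine n M) → ℂ, ‖f‖ ^ 2 ≤ ((n : ℝ) * L) ^ d * qW n M f := by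
    intro f
    refine (norm_sq_le_qW n M f).trans (mul_le_mul_of_nonneg_right ?_ (qW_nonneg n M f))
    rw [mul_pow]
    exact le_mul_of_one_le_right (by positivity) (one_le_pow₀ hL1)
  have hnormV : ∀ f' : Tor (fine L (fine n M)) → ℂ, ‖f'‖ ^ 2 ≤ ((n : ℝ) * L) ^ d * qV n L M f' := norm_sq_le_qV n L M
  refine pair_bracket (V := Tor (fine L (fine n M)) → ℂ) (W := Tor (fine n M) → ℂ) (Z := Tor M → ℂ)
    (Qk := Qk n M T) (Q₁ := Q1 n L M T') (Sc := Sc n M Rc) (Sf := Sf n L M R') (qW := qW n M) (qV := qV n L M) (qZ := nsq) (ρ := ρ)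
    (continuous_Qc T) (continuous_Qc T') ?_ ?_ (Q1_surjective n L M T' hT1)
    (Sc_nonneg n M Rc) (Sf_nonneg n L M R') (qV_nonneg n L M) (fun μ => nsq_nonneg μ)
    hnLd hΛ hCP hCR hδ hε₁ hε₂ hnormW hnormV hUBc hUBf ?_ ?_ ?_ hONE hREG μ
  · exact continuous_sum_dirU Rc _
  · exact continuous_sum_dirU R' _
  · intro f
    exact qW_le_coarse n M hG hc hframe hblock hsmall f
  · intro f'
    exact qV_le_composite n L M hG hc hframe hblock hsmall hG' hc' hframe' hblock' hsmall' hR' hT' hm hmis habsorb f'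
  · intro f'
    exact Sc_Q1_le n L M hR' hT' hm hmis f'

end Summit.QuantumFields.BalabanUV.T4Continuum.VariationalCovariantScalarPair

end
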